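import Mathlib
import HarnessLib
import Literature.Analysis.FluidPDE.ClassicalSolution
import Literature.Analysis.FluidPDE.VectorCalculus
import Summits.NavierStokesRegularity.NavierStokesRegularity.Theses.UnthreadedRigidityDoor
import Summits.NavierStokesRegularity.NavierStokesRegularity.Theorems.UnthreadedRigidityDoorUnthreadedRigidityMixedPairCompositions
import Summits.NavierStokesRegularity.NavierStokesRegularity.Theorems.UnthreadedRigidityDoorUnthreadedRigidityMixedPairCorelessDefs

/-!
# Route `UnthreadedRigidityDoor`, item `UnthreadedRigidity` (W2, stmt-NavierStokesRegularity-27585) — LINE g11-2 «MIXED PAIR», MAGIC SECTOR: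
# the kernel-checked COMPOSITIONS BY NAME (Theorems-side twin of the sketch's theorems, addenda 2A/2A′/2A″)

Prover file (engine-1 g71, DIRECTOR-NS dss_147 (3); `--supports stmt-NavierStokesRegularity-27585 --as helper`); VERBATIM from `MixedPair_sketch.lean`
v1.4: `helmholtzPairDead_of_null`, `helmholtzWindowDead_of_null` (S-H′ ⇒ S-H, S-HW), `magicPairOrderTwoRigidity_of_bridges`,
`magicPairWindowRigidity_of_crux/_of_bridges`, `magicPairOrderTwoRigidityAE_of_bridges(')`, `magicPairWindowRigidityAE_of_crux/_of_bridges(')`,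
`not_hasCore_of_null` (one binder renamed `hA → _hA`: unused-variable lint; statement unchanged).  Objects BY NAME in `…MixedPairDefs.lean` / `…MixedPairMagicDefs.lean`.

HONEST LABEL: plumbing of a RUNG line about SPECIAL two-shell data; `UnthreadedRigidity` (27585), W2 and NS regularity remain OPEN; nothing here is a
statement about the Navier–Stokes equations; nobody here claims `UnthreadedRigidity`.  0 kit.
-/

-- the summit and its single sub-problem share the name (CONVENTIONS §1), as in every Theorems file
set_option linter.dupNamespace false

namespace Summit.NavierStokesRegularity.NavierStokesRegularity.Theorems.UnthreadedRigidity.MixedPair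

open scoped Topology
open Filter Set
open Summit.NavierStokesRegularity.NavierStokesRegularity.Theorems.UnthreadedRigidity.ProfileHorn (E3 threadingFlux IsSliceAxisymmetric
  isSliceAxisymmetric_of_eq_zero curl_zero_field)
open Summit.NavierStokesRegularity.NavierStokesRegularity.Theorems.UnthreadedRigidity.VirialHorn (e det3 vortAmpL VirialAdmissible sepShellL
  WindowAxisUniform sepShellL_null)

/-- S-H′ ⇒ S-H (logic). -/
theorem helmholtzPairDead_of_null (h : HelmholtzLinkedNull) : HelmholtzPairDead := by
  intro t₀ T u p x₀ a Q H₁ H₂ _ _ _ _ hadm _ _ hhelm _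
  exact Or.inl (h H₁ H₂ hadm.2.2.1 hadm.2.2.2 hhelm).1

/-- S-H′ ⇒ S-HW (logic). -/
theorem helmholtzWindowDead_of_null (h : HelmholtzLinkedNull) : HelmholtzWindowDead := by
  intro S _ u x₀ _ _ _ _ _ a Q H₁f H₂f _ hslice t ht hhelm
  exact Or.inl (h (H₁f t) (H₂f t) (hslice t ht).1.2.2.1 (hslice t ht).1.2.2.2 hhelm).1

/-- COMPOSITION G-S (slice): O1 ∧ S-L ∧ G ∧ S-D ⇒ the magic slice rung. -/
theorem magicPairOrderTwoRigidity_of_bridges (hO1 : OrderOneLawPair) (hSL : OrderOneSilenceLinks) (hG : MagicGermRigidity)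
    (hD : DipoleShellAxisym) : MagicPairOrderTwoRigidity := by
  intro t₀ T u p x₀ a Q H₁ H₂ hT hsol hp hcd hadm hmag hnco hu hcore hA2 hj1 hj2
  have hlink : IsLinked H₁ H₂ := by
    apply hSL H₁ H₂ a Q hadm hnco
    intro y
    have key := hO1 t₀ T u p x₀ a Q H₁ H₂ hT hsol hp hcd hadm hu (y + x₀)
    rw [hj1 (y + x₀)] at key
    simp only [add_sub_cancel_right] at key
    have : -4 * ((H₁ ‖y‖ * vortAmpL 2 H₂ ‖y‖ - 3 * (H₂ ‖y‖ * vortAmpL 1 H₁ ‖y‖)) * det3 y a (Q y)) = 0 := key.symm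
    linarith [this]
  have h2 : IsNullProfile H₂ := hG t₀ T u p x₀ a Q H₁ H₂ hT hsol hp hcd hadm hmag hu hcore hA2 hlink hj2
  rw [hu, pairShell_of_null_right H₁ H₂ a Q x₀ h2]
  exact hD H₁ a x₀ hadm.1 hadm.2.2.1

/-- COMPOSITION G-R (bookkeeping): the magic window rung is a restriction of the crux. -/
theorem magicPairWindowRigidity_of_crux
    (h : Summit.NavierStokesRegularity.NavierStokesRegularity.Theses.UnthreadedRigidityDoor.UnthreadedRigidity) :
    MagicPairWindowRigidity := by
  intro S hS hconn u x₀ hcont hdiv hmild hbdd hunth _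
  exact h S hS hconn u x₀ hcont hdiv hmild hbdd hunth

/-- COMPOSITION G-W (kernel-checked): the MAGIC WINDOW rung follows from bridge G-W and the supports S-D, S-U. -/
theorem magicPairWindowRigidity_of_bridges (hR : MagicWindowReduction) (hD : DipoleShellAxisym) (hU : WindowAxisUniform) :
    MagicPairWindowRigidity := by
  intro S hS hconn u x₀ hcont hdiv hmild hbdd hunth hpair
  obtain ⟨a, Q, H₁f, H₂f, hmag, hslice⟩ := hpair
  have hax : ∀ t ∈ S, IsSliceAxisymmetric (u t) x₀ := by
    intro t ht
    have h2 : IsNullProfile (H₂f t) := hR S hS u x₀ hcont hdiv hmild hbdd hunth a Q H₁f H₂f hmag hslice t ht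
    rw [(hslice t ht).2.2, pairShell_of_null_right (H₁f t) (H₂f t) a Q x₀ h2]
    exact hD (H₁f t) a x₀ (hslice t ht).1.1 (hslice t ht).1.2.2.1
  exact hU S hS hconn u x₀ hcont hdiv hmild hbdd hax

/-- COMPOSITION G-S (AE, slice): O1 ∧ S-L ∧ G ∧ G-C ∧ S-P ∧ S-D ⇒ the magic slice rung for ALL analytic-even pairs (case split on the core). -/
theorem magicPairOrderTwoRigidityAE_of_bridges (hO1 : OrderOneLawPair) (hSL : OrderOneSilenceLinks) (hG : MagicGermRigidity)
    (hGC : MagicCorelessRigidity) (hP : PellBranchPositivity) (hD : DipoleShellAxisym) (hQU : UniaxialQuadShellAxisym) :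
    MagicPairOrderTwoRigidityAE := by
  intro t₀ T u p x₀ a Q H₁ H₂ hT hsol hp hcd hadm hmag hnco hu hA1 hA2 hj1 hj2
  -- THIRD BRANCH (v1.4, critic P1): the NULL DIPOLE — the slice is a lone uniaxial quadrupole shell, axisymmetric about `b` by S-QU.
  by_cases hN1 : IsNullProfile H₁
  · rw [hu, pairShell_of_null_left H₁ H₂ a Q x₀ hN1]
    exact hQU Q H₂ x₀ hmag.2.2 hadm.2.2.2
  have hlink : IsLinked H₁ H₂ := by
    apply hSL H₁ H₂ a Q hadm hnco
    intro y
    have key := hO1 t₀ T u p x₀ a Q H₁ H₂ hT hsol hp hcd hadm hu (y + x₀)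
    rw [hj1 (y + x₀)] at key
    simp only [add_sub_cancel_right] at key
    have : -4 * ((H₁ ‖y‖ * vortAmpL 2 H₂ ‖y‖ - 3 * (H₂ ‖y‖ * vortAmpL 1 H₁ ‖y‖)) * det3 y a (Q y)) = 0 := key.symm
    linarith [this]
  have h2 : IsNullProfile H₂ := by
    by_cases hc : HasCore H₁
    · exact hG t₀ T u p x₀ a Q H₁ H₂ hT hsol hp hcd hadm hmag hu hc hA2 hlink hj2
    · exact hGC hP t₀ T u p x₀ a Q H₁ H₂ hT hsol hp hcd hadm hmag hu hA1 hc hN1 hA2 hlink hj2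
  rw [hu, pairShell_of_null_right H₁ H₂ a Q x₀ h2]
  exact hD H₁ a x₀ hadm.1 hadm.2.2.1

/-- COMPOSITION G-R (AE, bookkeeping): the AE magic window rung is a restriction of the crux. -/
theorem magicPairWindowRigidityAE_of_crux
    (h : Summit.NavierStokesRegularity.NavierStokesRegularity.Theses.UnthreadedRigidityDoor.UnthreadedRigidity) :
    MagicPairWindowRigidityAE := by
  intro S hS hconn u x₀ hcont hdiv hmild hbdd hunth _
  exact h S hS hconn u x₀ hcont hdiv hmild hbdd hunth

/-- COMPOSITION G-W (AE, kernel-checked): the AE MAGIC WINDOW rung follows from bridge G-W (AE), S-P and the supports S-D, S-U. -/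
theorem magicPairWindowRigidityAE_of_bridges (hR : MagicWindowReductionAE) (hP : PellBranchPositivity) (hD : DipoleShellAxisym)
    (hQU : UniaxialQuadShellAxisym) (hU : WindowAxisUniform) : MagicPairWindowRigidityAE := by
  intro S hS hconn u x₀ hcont hdiv hmild hbdd hunth hpair
  obtain ⟨a, Q, H₁f, H₂f, hmag, hslice⟩ := hpair
  have hax : ∀ t ∈ S, IsSliceAxisymmetric (u t) x₀ := by
    intro t ht
    -- v1.4 (critic P1): the bridge reports WHICH profile is null; null dipole ⇒ S-QU (axis `b`), null quadrupole ⇒ S-D (axis `a`).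
    rcases hR hP S hS u x₀ hcont hdiv hmild hbdd hunth a Q H₁f H₂f hmag hslice t ht with h1 | h2
    · rw [(hslice t ht).2, pairShell_of_null_left (H₁f t) (H₂f t) a Q x₀ h1]
      exact hQU Q (H₂f t) x₀ hmag.2.2 (hslice t ht).1.2.2.2
    · rw [(hslice t ht).2, pairShell_of_null_right (H₁f t) (H₂f t) a Q x₀ h2]
      exact hD (H₁f t) a x₀ (hslice t ht).1.1 (hslice t ht).1.2.2.1
  exact hU S hS hconn u x₀ hcont hdiv hmild hbdd hax

/-- With S-P proved: O1 ∧ S-L ∧ G ∧ G-C ∧ S-D ∧ S-QU ⇒ the AE magic slice rung. -/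
theorem magicPairOrderTwoRigidityAE_of_bridges' (hO1 : OrderOneLawPair) (hSL : OrderOneSilenceLinks) (hG : MagicGermRigidity)
    (hGC : MagicCorelessRigidity) (hD : DipoleShellAxisym) (hQU : UniaxialQuadShellAxisym) : MagicPairOrderTwoRigidityAE :=
  magicPairOrderTwoRigidityAE_of_bridges hO1 hSL hG hGC pellBranchPositivity_holds hD hQU

/-- With S-P proved: G-W-AE ∧ S-D ∧ S-QU ∧ S-U ⇒ the AE MAGIC WINDOW rung (27585 verbatim on magic-pair windows, no core hypothesis). -/
theorem magicPairWindowRigidityAE_of_bridges' (hR : MagicWindowReductionAE) (hD : DipoleShellAxisym) (hQU : UniaxialQuadShellAxisym)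
    (hU : WindowAxisUniform) : MagicPairWindowRigidityAE :=
  magicPairWindowRigidityAE_of_bridges hR pellBranchPositivity_holds hD hQU hU

/-- v1.4 bookkeeping (critic P1 (i)): for an ANALYTIC-EVEN profile, «coreless and non-null» is the honest hypothesis of G-C — a null profile is
(trivially) coreless, so `¬ HasCore` alone can never exclude the null dipole. -/
lemma not_hasCore_of_null {H : ℝ → ℝ} (_hA : IsAnalyticEven H) (hN : IsNullProfile H) : ¬ HasCore H := by
  rintro ⟨h, _, hH, h0⟩
  apply h0
  have := hH 0 le_rfl
  rw [hN 0 le_rfl] at this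
  simpa using this.symm

end Summit.NavierStokesRegularity.NavierStokesRegularity.Theorems.UnthreadedRigidity.MixedPair
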